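import Mathlib

/-!
# Certified bracket for the depletion ratio (route K, test-charge calculus)

Kernel K28 of the solo-blind programme (session s59).  Pure real arithmetic, Mathlib only.

For the hard-core `n`-boson problem on the torus the depletion ratio is, exactly,
`r = (λ + β'/k)(1+T) / (T (1 + m λ + β))` with `k = n-1`, `m = n(n-1)/2`
(`depletionRatioN_eq` of K27).  The test-charge calculus (paper, ROUTE_KJ_s59 §1) produces,
from a variational upper bound `s_up ≥ s_n` and an explicit test charge, *brackets*
`λ ∈ [λLo, λHi]`, `β' ∈ [β'Lo, β'Hi]`, `β ∈ [βLo, βHi]`.  This file proves the glue: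

* `temple_lower_bound` — the Temple-type inequality `s_up - Θ(s_up) s_up²/m ≤ s_n` from
  `0 ≤ Θ(s_n)` and the slope bound `Θ(s_up) - Θ(s) ≥ (s_up - s) m / s_up²`;
* `lam_bracket` — the bracket for `λ` from `|λ - λφ(s_n)| ≤ A` and monotonicity of `λφ`;
* `depletionRatioFn_mono_lam / _mono_bp / _anti_b` — monotonicity of `r` in each argument
  (in `λ` under the condition `(m/k) β' ≤ 1 + β`);
* `depletionRatio_bracket` — the two-sided bracket for `r`.
-/

namespace Summit.AtomisticToContinuum.BoseEinsteinCondensation.Theorems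

/-- The depletion-ratio function `r(λ, β', β) = (λ + β'/k)(1+T)/(T(1+mλ+β))`. -/
noncomputable def depletionRatioFn (k m T lam bp b : ℝ) : ℝ :=
  (lam + bp / k) * (1 + T) / (T * (1 + m * lam + b))

/-- Temple-type lower bound for the ground-state energy from a test charge:
if `Θ(s_n) ≥ 0` and `Θ(s_up) - Θ(s) ≥ (s_up - s) m / s_up²` for `s ≤ s_up`, then
`s_n ≥ s_up - Θ(s_up) s_up² / m`. -/
theorem temple_lower_bound (Θ : ℝ → ℝ) (sn sup m : ℝ) (hm : 0 < m) (hsup : 0 < sup)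
    (h0 : 0 ≤ Θ sn) (hle : sn ≤ sup)
    (hslope : ∀ s, s ≤ sup → (sup - s) * m / sup ^ 2 ≤ Θ sup - Θ s) :
    sup - Θ sup * sup ^ 2 / m ≤ sn := by
  have h1 := hslope sn hle
  have hsup2 : 0 < sup ^ 2 := by positivity
  -- (sup - sn) * m / sup^2 ≤ Θ sup - Θ sn ≤ Θ sup
  have h2 : (sup - sn) * m / sup ^ 2 ≤ Θ sup := by linarith
  have h3 : (sup - sn) * m ≤ Θ sup * sup ^ 2 := by
    have := (div_le_iff₀ hsup2).mp h2
    linarith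
  have h4 : sup - sn ≤ Θ sup * sup ^ 2 / m := by
    rw [le_div_iff₀ hm]; linarith
  linarith

/-- Bracket for `λ`: from `|λ - λφ(s_n)| ≤ A` and `λφ(s₋) ≤ λφ(s_n) ≤ λφ(s_up)`. -/
theorem lam_bracket (lam lamAt lamLoVal lamHiVal A : ℝ)
    (hA : |lam - lamAt| ≤ A) (hlo : lamLoVal ≤ lamAt) (hhi : lamAt ≤ lamHiVal) :
    lamLoVal - A ≤ lam ∧ lam ≤ lamHiVal + A := by
  have h := abs_le.mp hA
  constructor <;> linarith [h.1, h.2]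

/-- Bracket for `β` (or `β'`) from the weighted triangle inequality:
`√βφ(s₋) - d ≤ √β ≤ √βφ(s_up) + d` gives `(max (√βφ(s₋) - d) 0)² ≤ β ≤ (√βφ(s_up) + d)²`. -/
theorem beta_bracket (β x y d : ℝ) (hβ : 0 ≤ β)
    (hlo : x - d ≤ Real.sqrt β) (hhi : Real.sqrt β ≤ y + d) :
    (max (x - d) 0) ^ 2 ≤ β ∧ β ≤ (y + d) ^ 2 := by
  have hs : 0 ≤ Real.sqrt β := Real.sqrt_nonneg β
  have hsq : Real.sqrt β ^ 2 = β := Real.sq_sqrt hβ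
  constructor
  · have hmax : max (x - d) 0 ≤ Real.sqrt β := max_le hlo hs
    have hmax0 : 0 ≤ max (x - d) 0 := le_max_right _ _
    calc (max (x - d) 0) ^ 2 ≤ Real.sqrt β ^ 2 := by
          exact pow_le_pow_left₀ hmax0 hmax 2
      _ = β := hsq
  · have hyd : 0 ≤ y + d := le_trans hs hhi
    calc β = Real.sqrt β ^ 2 := hsq.symm
      _ ≤ (y + d) ^ 2 := by exact pow_le_pow_left₀ hs hhi 2

/-- Monotonicity of `r` in `λ` under `(m/k) β' ≤ 1 + β`. -/
theorem depletionRatioFn_mono_lam (k m T lam₁ lam₂ bp b : ℝ) (hT : 0 < T) (_hk : 0 < k)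
    (hD₁ : 0 < 1 + m * lam₁ + b) (hD₂ : 0 < 1 + m * lam₂ + b) (hle : lam₁ ≤ lam₂)
    (hmono : m / k * bp ≤ 1 + b) :
    depletionRatioFn k m T lam₁ bp b ≤ depletionRatioFn k m T lam₂ bp b := by
  unfold depletionRatioFn
  have hT1 : 0 < 1 + T := by linarith
  rw [div_le_div_iff₀ (by positivity) (by positivity)]
  -- (lam₁ + c)(1+T) * (T * D₂) ≤ (lam₂ + c)(1+T) * (T * D₁)
  have key : (lam₁ + bp / k) * (1 + m * lam₂ + b) ≤ (lam₂ + bp / k) * (1 + m * lam₁ + b) := by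
    have hc : m * (bp / k) ≤ 1 + b := by
      have : m / k * bp = m * (bp / k) := by ring
      linarith [this ▸ hmono]
    -- difference = (lam₁ - lam₂) * (1 + b - m * (bp/k)) ≤ 0
    nlinarith [mul_nonneg (sub_nonneg.mpr hle) (sub_nonneg.mpr hc)]
  have hTT : 0 ≤ (1 + T) * T := by positivity
  have := mul_le_mul_of_nonneg_left key hTT
  nlinarith [this]

/-- Monotonicity of `r` in `β'`. -/
theorem depletionRatioFn_mono_bp (k m T lam bp₁ bp₂ b : ℝ) (hT : 0 < T) (hk : 0 < k)
    (hD : 0 < 1 + m * lam + b) (hle : bp₁ ≤ bp₂) :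
    depletionRatioFn k m T lam bp₁ b ≤ depletionRatioFn k m T lam bp₂ b := by
  unfold depletionRatioFn
  have hT1 : 0 < 1 + T := by linarith
  apply div_le_div_of_nonneg_right _ (by positivity)
  apply mul_le_mul_of_nonneg_right _ hT1.le
  have : bp₁ / k ≤ bp₂ / k := div_le_div_of_nonneg_right hle hk.le
  linarith

/-- Antitonicity of `r` in `β` (numerator nonnegative). -/
theorem depletionRatioFn_anti_b (k m T lam bp b₁ b₂ : ℝ) (hT : 0 < T)
    (hD₁ : 0 < 1 + m * lam + b₁) (hle : b₁ ≤ b₂) (hnum : 0 ≤ lam + bp / k) :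
    depletionRatioFn k m T lam bp b₂ ≤ depletionRatioFn k m T lam bp b₁ := by
  unfold depletionRatioFn
  have hT1 : 0 < 1 + T := by linarith
  have hD₂ : 0 < 1 + m * lam + b₂ := by linarith
  apply div_le_div_of_nonneg_left (by positivity) (by positivity)
  exact mul_le_mul_of_nonneg_left (by linarith) hT.le

/-- **Certified bracket for the depletion ratio.**  If `λ ∈ [λLo, λHi]`, `β' ∈ [β'Lo, β'Hi]`,
`β ∈ [βLo, βHi]`, the denominators are positive (`0 < 1 + m λLo + βLo`, `m ≥ 0`), the numerator is
nonnegative (`0 ≤ λLo + β'Lo/k`) and the monotonicity condition `(m/k) β'Hi ≤ 1 + βLo` holds, then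
`r(λLo, β'Lo, βHi) ≤ r(λ, β', β) ≤ r(λHi, β'Hi, βLo)`. -/
theorem depletionRatio_bracket (k m T lam bp b lamLo lamHi bpLo bpHi bLo bHi : ℝ)
    (hT : 0 < T) (hk : 0 < k) (hm : 0 ≤ m)
    (hlam : lamLo ≤ lam ∧ lam ≤ lamHi) (hbp : bpLo ≤ bp ∧ bp ≤ bpHi) (hb : bLo ≤ b ∧ b ≤ bHi)
    (hnum : 0 ≤ lamLo + bpLo / k) (hD : 0 < 1 + m * lamLo + bLo)
    (hmono : m / k * bpHi ≤ 1 + bLo) :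
    depletionRatioFn k m T lamLo bpLo bHi ≤ depletionRatioFn k m T lam bp b ∧
      depletionRatioFn k m T lam bp b ≤ depletionRatioFn k m T lamHi bpHi bLo := by
  obtain ⟨hl1, hl2⟩ := hlam
  obtain ⟨hp1, hp2⟩ := hbp
  obtain ⟨hb1, hb2⟩ := hb
  have hmk : 0 ≤ m / k := div_nonneg hm hk.le
  -- positivity of all denominators along the monotone path
  have hDlo_hi : 0 < 1 + m * lamLo + bHi := by nlinarith [mul_nonneg hm (le_refl 0)]
  have hD_hi : 0 < 1 + m * lam + bHi := by nlinarith [mul_le_mul_of_nonneg_left hl1 hm]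
  have hD_b : 0 < 1 + m * lam + b := by nlinarith [mul_le_mul_of_nonneg_left hl1 hm]
  have hD_lo : 0 < 1 + m * lam + bLo := by nlinarith [mul_le_mul_of_nonneg_left hl1 hm]
  have hDhi_lo : 0 < 1 + m * lamHi + bLo := by
    nlinarith [mul_le_mul_of_nonneg_left (le_trans hl1 hl2) hm]
  -- monotonicity conditions along the path
  have hmono1 : m / k * bpLo ≤ 1 + bHi := by
    have : m / k * bpLo ≤ m / k * bpHi := mul_le_mul_of_nonneg_left (le_trans hp1 hp2) hmk
    linarith
  have hmono2 : m / k * bpHi ≤ 1 + bLo := hmono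
  -- numerator nonnegativity
  have hnum1 : 0 ≤ lam + bpLo / k := by
    have : bpLo / k ≤ bpLo / k := le_refl _
    have h' : lamLo + bpLo / k ≤ lam + bpLo / k := by linarith
    linarith
  have hnum2 : 0 ≤ lam + bp / k := by
    have : bpLo / k ≤ bp / k := div_le_div_of_nonneg_right hp1 hk.le
    linarith
  constructor
  · calc depletionRatioFn k m T lamLo bpLo bHi
        ≤ depletionRatioFn k m T lam bpLo bHi :=
          depletionRatioFn_mono_lam k m T lamLo lam bpLo bHi hT hk hDlo_hi hD_hi hl1 hmono1
      _ ≤ depletionRatioFn k m T lam bp bHi :=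
          depletionRatioFn_mono_bp k m T lam bpLo bp bHi hT hk hD_hi hp1
      _ ≤ depletionRatioFn k m T lam bp b :=
          depletionRatioFn_anti_b k m T lam bp b bHi hT hD_b hb2 hnum2
  · calc depletionRatioFn k m T lam bp b
        ≤ depletionRatioFn k m T lam bp bLo :=
          depletionRatioFn_anti_b k m T lam bp bLo b hT hD_lo hb1 hnum2
      _ ≤ depletionRatioFn k m T lam bpHi bLo :=
          depletionRatioFn_mono_bp k m T lam bp bpHi bLo hT hk hD_lo hp2
      _ ≤ depletionRatioFn k m T lamHi bpHi bLo :=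
          depletionRatioFn_mono_lam k m T lam lamHi bpHi bLo hT hk hD_lo hDhi_lo hl2 hmono2

/-- The width of the certified bracket vanishes when the input brackets collapse
(sanity statement: equal endpoints give equal values). -/
theorem depletionRatio_bracket_exact (k m T lam bp b : ℝ) :
    depletionRatioFn k m T lam bp b = (lam + bp / k) * (1 + T) / (T * (1 + m * lam + b)) := rfl

end Summit.AtomisticToContinuum.BoseEinsteinCondensation.Theorems
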